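import Literature.Computability.AlgebraicComplexity.SymmetricArithCircuit
import Literature.Computability.AlgebraicComplexity.PICircuitNodeValues
import Mathlib.Tactic.DeriveFintype
import Mathlib.Data.Fintype.BigOperators
import Mathlib.Tactic.Linarith
import Mathlib.Tactic.Ring
import Mathlib.Tactic.FinCases
import HarnessLib

/-!
# Symmetrization by orbit averaging: the circuit

Given a Hrubeš–Tzameret straight-line circuit `C : PICircuit 𝔽 X` (`PIProof.lean`, HT §1.1) and a
finite group `Γ` acting on the variables `X`, this file builds the **orbit-averaging circuit** of
`C`: a Dawar–Wilsenach labelled arithmetic circuit (`SymmetricArithCircuit.lean`, DW Def. 2.2) on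
which `Γ` ACTS by circuit automorphisms (a `SymmetricArithmeticCircuit Γ`, hence `IsSymmetric Γ`,
DW Def. 3.7), consisting of

* one input gate per variable `x ∈ X` and one per constant of `C` (plus `0` and the averaging
  constant `u`) — DW circuits have injective labels on input gates, so the possibly repeated
  leaves of `C` must be shared;
* for every `γ ∈ Γ` and every node `p` of `C` a gate `node γ p` computing the `γ`-relabelled
  value of node `p`, and a fan-in-one sum gate `copy γ p` of it — DW gates have a SET of children,
  so a node `F + F` / `F × F` of `C` (both references equal) needs two distinct child gates
  computing `F`; leaves of `C` become fan-in-one sums of the shared input gate; junk references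
  of `C` (HT's convention: value `0`) go to the constant `0` resp. to an auxiliary gate `zero'`;
* the averaging gate `avg = Σ_γ node γ (|C| - 1)` and the output `out = avg × u`.

`Γ` permutes the copies (`δ • node γ p = node (δγ) p`) and the variable inputs and fixes the
rest; wires go to wires, labels transform correctly, the output is fixed
(`PICircuit.orbitAvgCircuit`). Size: `|X| + |constSet| + 2|Γ||C| + 3 ≤ |X| + (2|Γ|+1)|C| + 5`
(`PICircuit.card_oaGate_le`). The semantics (`out` computes `Ĉ` when `Ĉ` is `Γ`-invariant and
`|Γ| u = 1`) is in `OrbitAveragingCircuitEval.lean`. Folklore (the standard averaging argument;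
cf. Dawar–Wilsenach §3.3 on symmetric circuits for invariant polynomials); everything proved.
It records the TRIVIAL `|Γ|`-cost restoration of symmetry against which the restoration
statements `RestorationQP`, `StabilityOfProvableSymmetry` of route
`Summits/ValiantsHypothesis/ValiantsHypothesis/Theses/ProofCarryingSymmetry.lean` are measured.
-/

noncomputable section

namespace Literature.Computability.AlgebraicComplexity

open MvPolynomial

universe u v w

/-! ### The gates of the orbit-averaging circuit -/

/-- Gates of the orbit-averaging circuit built from a straight-line circuit with `s` nodes, a
group `Γ`, variables `X` and a type `S` of constants: the input gates (one per variable and one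
per constant), for every `γ ∈ Γ` and every node `p` a gate `node γ p` (the `γ`-relabelled copy of
node `p`) and a fan-in-one copy `copy γ p` of it, an auxiliary gate `zero'` computing `0`, the
averaging gate `avg = Σ_γ node γ (s-1)` and the output `out = avg × (1/|Γ|)`. [folklore] -/
inductive OrbitAvgGate (X : Type v) (Γ : Type w) (S : Type u) (s : ℕ) : Type (max u v w)
  /-- input gate labelled by the variable `x` -/
  | inp (x : X) : OrbitAvgGate X Γ S s
  /-- input gate labelled by the constant `c` -/
  | cst (c : S) : OrbitAvgGate X Γ S s
  /-- the `γ`-relabelled copy of node `p` -/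
  | node (γ : Γ) (p : Fin s) : OrbitAvgGate X Γ S s
  /-- a fan-in-one sum gate copying `node γ p` -/
  | copy (γ : Γ) (p : Fin s) : OrbitAvgGate X Γ S s
  /-- a fan-in-one sum gate copying the constant `0` -/
  | zero' : OrbitAvgGate X Γ S s
  /-- the averaging gate `Σ_γ node γ (s - 1)` -/
  | avg : OrbitAvgGate X Γ S s
  /-- the output gate `avg × (1/|Γ|)` -/
  | out : OrbitAvgGate X Γ S s
  deriving DecidableEq, Fintype

namespace OrbitAvgGate

variable {X : Type v} {Γ : Type w} {S : Type u} {s : ℕ}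

/-- Rank of a gate, increasing along wires (acyclicity). [folklore] -/
def rank : OrbitAvgGate X Γ S s → ℕ
  | inp _ => 0
  | cst _ => 0
  | node _ p => 2 * p + 2
  | copy _ p => 2 * p + 3
  | zero' => 1
  | avg => 2 * s + 2
  | out => 2 * s + 3

/-- The gates as a sum type (for counting). [folklore] -/
def equivSum : OrbitAvgGate X Γ S s ≃ X ⊕ S ⊕ (Γ × Fin s) ⊕ (Γ × Fin s) ⊕ Fin 3 where
  toFun
    | inp x => Sum.inl x
    | cst c => Sum.inr (Sum.inl c)
    | node γ p => Sum.inr (Sum.inr (Sum.inl (γ, p)))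
    | copy γ p => Sum.inr (Sum.inr (Sum.inr (Sum.inl (γ, p))))
    | zero' => Sum.inr (Sum.inr (Sum.inr (Sum.inr 0)))
    | avg => Sum.inr (Sum.inr (Sum.inr (Sum.inr 1)))
    | out => Sum.inr (Sum.inr (Sum.inr (Sum.inr 2)))
  invFun
    | Sum.inl x => inp x
    | Sum.inr (Sum.inl c) => cst c
    | Sum.inr (Sum.inr (Sum.inl (γ, p))) => node γ p
    | Sum.inr (Sum.inr (Sum.inr (Sum.inl (γ, p)))) => copy γ p
    | Sum.inr (Sum.inr (Sum.inr (Sum.inr 0))) => zero'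
    | Sum.inr (Sum.inr (Sum.inr (Sum.inr 1))) => avg
    | Sum.inr (Sum.inr (Sum.inr (Sum.inr 2))) => out
  left_inv g := by cases g <;> rfl
  right_inv t := by
    rcases t with x | c | ⟨γ, p⟩ | ⟨γ, p⟩ | k <;> [rfl; rfl; rfl; rfl; (fin_cases k <;> rfl)]

/-- The number of gates: `|X| + |S| + 2 |Γ| s + 3`. [folklore] -/
theorem card_eq [Fintype X] [Fintype Γ] [Fintype S] :
    Fintype.card (OrbitAvgGate X Γ S s) =
      Fintype.card X + Fintype.card S + 2 * (Fintype.card Γ * s) + 3 := by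
  rw [Fintype.card_congr equivSum]
  simp only [Fintype.card_sum, Fintype.card_prod, Fintype.card_fin]
  ring

variable [Group Γ] [MulAction Γ X]

/-- `Γ` acts on the gates: by its action on the variable inputs and by left translation on the
copies; constants, `zero'`, `avg`, `out` are fixed. [folklore] -/
instance instMulAction : MulAction Γ (OrbitAvgGate X Γ S s) where
  smul δ
    | inp x => inp (δ • x)
    | cst c => cst c
    | node γ p => node (δ * γ) p
    | copy γ p => copy (δ * γ) p
    | zero' => zero'
    | avg => avg
    | out => out
  one_smul g := by
    cases g with
    | inp x => exact congrArg inp (one_smul _ x)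
    | cst c => rfl
    | node γ p => exact congrArg₂ node (one_mul γ) rfl
    | copy γ p => exact congrArg₂ copy (one_mul γ) rfl
    | zero' => rfl
    | avg => rfl
    | out => rfl
  mul_smul δ δ' g := by
    cases g with
    | inp x => exact congrArg inp (mul_smul δ δ' x)
    | cst c => rfl
    | node γ p => exact congrArg₂ node (mul_assoc δ δ' γ) rfl
    | copy γ p => exact congrArg₂ copy (mul_assoc δ δ' γ) rfl
    | zero' => rfl
    | avg => rfl
    | out => rfl

/-- The action on variable inputs. [folklore] -/
@[simp] theorem smul_inp (δ : Γ) (x : X) : δ • (inp x : OrbitAvgGate X Γ S s) = inp (δ • x) := rfl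
/-- Constant inputs are fixed. [folklore] -/
@[simp] theorem smul_cst (δ : Γ) (c : S) : δ • (cst c : OrbitAvgGate X Γ S s) = cst c := rfl
/-- The action on node copies: left translation. [folklore] -/
@[simp] theorem smul_node (δ γ : Γ) (p : Fin s) : δ • (node γ p : OrbitAvgGate X Γ S s) = node (δ * γ) p := rfl
/-- The action on fan-in-one copies: left translation. [folklore] -/
@[simp] theorem smul_copy (δ γ : Γ) (p : Fin s) : δ • (copy γ p : OrbitAvgGate X Γ S s) = copy (δ * γ) p := rfl
/-- `zero'` is fixed. [folklore] -/
@[simp] theorem smul_zero' (δ : Γ) : δ • (zero' : OrbitAvgGate X Γ S s) = zero' := rfl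
/-- `avg` is fixed. [folklore] -/
@[simp] theorem smul_avg (δ : Γ) : δ • (avg : OrbitAvgGate X Γ S s) = avg := rfl
/-- `out` is fixed. [folklore] -/
@[simp] theorem smul_out (δ : Γ) : δ • (out : OrbitAvgGate X Γ S s) = out := rfl

end OrbitAvgGate

/-! ### The orbit-averaging circuit -/

namespace PICircuit

variable {𝔽 : Type u} {X : Type v} {Γ : Type w} [Group Γ] [MulAction Γ X]

/-- The label of the copies of a node: leaves become fan-in-one sums of the corresponding input
gate, `+`/`×` nodes keep their operation. [folklore] -/
def nodeLabel : Node 𝔽 X → CircuitLabel 𝔽 X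
  | .var _ => .add
  | .const _ => .add
  | .add _ _ => .add
  | .mul _ _ => .mul

/-- `nodeLabel` is never an input label. [folklore] -/
theorem not_isInput_nodeLabel (nd : Node 𝔽 X) : ¬ (nodeLabel nd).IsInput := by
  cases nd <;> simp [nodeLabel]

/-- A variable label is not a `nodeLabel`. [folklore] -/
@[simp] theorem var_ne_nodeLabel (x : X) (nd : Node 𝔽 X) :
    (CircuitLabel.var x : CircuitLabel 𝔽 X) ≠ nodeLabel nd := by
  cases nd <;> simp [nodeLabel]

/-- A constant label is not a `nodeLabel`. [folklore] -/
@[simp] theorem const_ne_nodeLabel (c : 𝔽) (nd : Node 𝔽 X) :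
    (CircuitLabel.const c : CircuitLabel 𝔽 X) ≠ nodeLabel nd := by
  cases nd <;> simp [nodeLabel]

/-- The action fixes `nodeLabel`s. [folklore] -/
@[simp] theorem smul_nodeLabel (δ : Γ) (nd : Node 𝔽 X) : δ • nodeLabel nd = nodeLabel nd := by
  cases nd <;> rfl

/-- The last node index. [folklore] -/
def lastFin (C : PICircuit 𝔽 X) : Fin C.size := ⟨C.size - 1, Nat.sub_lt C.one_le_size Nat.one_pos⟩

section Gates

variable [Zero 𝔽] [DecidableEq 𝔽] (C : PICircuit 𝔽 X) (u : 𝔽)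

/-- The gate type of the orbit-averaging circuit of `C` (with averaging constant `u`). [folklore] -/
abbrev OAGate (Γ : Type w) (C : PICircuit 𝔽 X) (u : 𝔽) : Type (max u v w) :=
  OrbitAvgGate X Γ (C.constSet u) C.size

variable (Γ) in
/-- The constant input gate labelled `c` (junk: the gate `0` if `c` is not a constant of `C`). [folklore] -/
def cgate (c : 𝔽) : C.OAGate Γ u :=
  if h : c ∈ C.constSet u then .cst ⟨c, h⟩ else .cst ⟨0, C.zero_mem_constSet u⟩

omit [Group Γ] [MulAction Γ X] in
/-- `cgate c` is the constant gate `c` for constants of `C`. [folklore] -/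
theorem cgate_eq_of_mem {c : 𝔽} (h : c ∈ C.constSet u) : C.cgate Γ u c = .cst ⟨c, h⟩ := by
  unfold cgate; rw [dif_pos h]

/-- The left child of the copy `node γ p`: the copy `node γ i` of the referenced node, or the
constant `0` for a junk reference. [folklore] -/
def lchild (γ : Γ) (p : Fin C.size) (i : ℕ) : C.OAGate Γ u :=
  if h : i < p.val then .node γ ⟨i, h.trans p.isLt⟩ else .cst ⟨0, C.zero_mem_constSet u⟩

/-- The right child of the copy `node γ p`: the fan-in-one copy `copy γ j` of the referenced node
(so that the two children are distinct gates even when `i = j`), or `zero'` for a junk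
reference. [folklore] -/
def rchild (γ : Γ) (p : Fin C.size) (j : ℕ) : C.OAGate Γ u :=
  if h : j < p.val then .copy γ ⟨j, h.trans p.isLt⟩ else .zero'

omit [Group Γ] [MulAction Γ X] in
/-- The two children of a copy are distinct gates. [folklore] -/
theorem lchild_ne_rchild (γ : Γ) (p : Fin C.size) (i j : ℕ) : C.lchild u γ p i ≠ C.rchild u γ p j := by
  unfold lchild rchild; split_ifs <;> simp

/-- The action commutes with `lchild`. [folklore] -/
theorem smul_lchild (δ γ : Γ) (p : Fin C.size) (i : ℕ) :
    δ • C.lchild u γ p i = C.lchild u (δ * γ) p i := by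
  unfold lchild; split_ifs <;> rfl

/-- The action commutes with `rchild`. [folklore] -/
theorem smul_rchild (δ γ : Γ) (p : Fin C.size) (j : ℕ) :
    δ • C.rchild u γ p j = C.rchild u (δ * γ) p j := by
  unfold rchild; split_ifs <;> rfl

/-- The action fixes `cgate`. [folklore] -/
theorem smul_cgate (δ : Γ) (c : 𝔽) : δ • C.cgate Γ u c = C.cgate Γ u c := by
  unfold cgate; split_ifs <;> rfl

variable (Γ) in
/-- Labels in the orbit-averaging circuit. [folklore] -/
def oaLabel : C.OAGate Γ u → CircuitLabel 𝔽 X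
  | .inp x => .var x
  | .cst c => .const c.val
  | .node _ p => nodeLabel (C.nodeAt p)
  | .copy _ _ => .add
  | .zero' => .add
  | .avg => .add
  | .out => .mul

variable [DecidableEq X] [DecidableEq Γ]

/-- The children of the copy `node γ p`, by the kind of node `p`. [folklore] -/
def nodeChildren (γ : Γ) (p : Fin C.size) : Node 𝔽 X → Finset (C.OAGate Γ u)
  | .var x => {.inp (γ • x)}
  | .const c => {C.cgate Γ u c}
  | .add i j => {C.lchild u γ p i, C.rchild u γ p j}
  | .mul i j => {C.lchild u γ p i, C.rchild u γ p j}

/-- `nodeChildren` is nonempty. [folklore] -/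
theorem nodeChildren_nonempty (γ : Γ) (p : Fin C.size) (nd : Node 𝔽 X) :
    (C.nodeChildren u γ p nd).Nonempty := by
  cases nd <;> simp [nodeChildren]

/-- The action commutes with `nodeChildren`. [folklore] -/
theorem nodeChildren_smul (δ γ : Γ) (p : Fin C.size) (nd : Node 𝔽 X) :
    C.nodeChildren u (δ * γ) p nd =
      (C.nodeChildren u γ p nd).map (MulAction.toPerm δ : Equiv.Perm (C.OAGate Γ u)).toEmbedding := by
  cases nd with
  | var x => simp [nodeChildren, mul_smul]
  | const c => simp [nodeChildren, smul_cgate]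
  | add i j => simp [nodeChildren, Finset.map_insert, smul_lchild, smul_rchild]
  | mul i j => simp [nodeChildren, Finset.map_insert, smul_lchild, smul_rchild]

variable [Fintype Γ]

variable (Γ) in
/-- Children in the orbit-averaging circuit. [folklore] -/
def oaChildren : C.OAGate Γ u → Finset (C.OAGate Γ u)
  | .inp _ => ∅
  | .cst _ => ∅
  | .node γ p => C.nodeChildren u γ p (C.nodeAt p)
  | .copy γ p => {.node γ p}
  | .zero' => {.cst ⟨0, C.zero_mem_constSet u⟩}
  | .avg => Finset.univ.image fun γ : Γ => .node γ C.lastFin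
  | .out => {.avg, .cst ⟨u, C.mem_constSet_self u⟩}

/-- Children have smaller rank. [folklore] -/
theorem rank_lt_of_mem_oaChildren {g h : C.OAGate Γ u} (hh : h ∈ C.oaChildren Γ u g) :
    h.rank < g.rank := by
  cases g with
  | inp x => simp [oaChildren] at hh
  | cst c => simp [oaChildren] at hh
  | node γ p =>
    simp only [oaChildren] at hh
    cases hnd : C.nodeAt p with
    | var x =>
      rw [hnd] at hh; simp only [nodeChildren, Finset.mem_singleton] at hh
      subst hh; simp [OrbitAvgGate.rank]
    | const c =>
      rw [hnd] at hh; simp only [nodeChildren, Finset.mem_singleton] at hh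
      subst hh; unfold cgate; split_ifs <;> simp [OrbitAvgGate.rank]
    | add i j =>
      rw [hnd] at hh; simp only [nodeChildren, Finset.mem_insert, Finset.mem_singleton] at hh
      rcases hh with rfl | rfl
      · unfold lchild; split_ifs <;> simp [OrbitAvgGate.rank]; omega
      · unfold rchild; split_ifs <;> simp [OrbitAvgGate.rank]; omega
    | mul i j =>
      rw [hnd] at hh; simp only [nodeChildren, Finset.mem_insert, Finset.mem_singleton] at hh
      rcases hh with rfl | rfl
      · unfold lchild; split_ifs <;> simp [OrbitAvgGate.rank]; omega
      · unfold rchild; split_ifs <;> simp [OrbitAvgGate.rank]; omega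
  | copy γ p => simp only [oaChildren, Finset.mem_singleton] at hh; subst hh; simp [OrbitAvgGate.rank]
  | zero' => simp only [oaChildren, Finset.mem_singleton] at hh; subst hh; simp [OrbitAvgGate.rank]
  | avg =>
    simp only [oaChildren, Finset.mem_image, Finset.mem_univ, true_and] at hh
    obtain ⟨γ, rfl⟩ := hh
    have := C.one_le_size
    simp only [OrbitAvgGate.rank, lastFin]; omega
  | out =>
    simp only [oaChildren, Finset.mem_insert, Finset.mem_singleton] at hh
    rcases hh with rfl | rfl <;> simp [OrbitAvgGate.rank]

variable (Γ) in
/-- **The orbit-averaging circuit** of a straight-line circuit `C` over variables `X` acted on by a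
finite group `Γ`, with averaging constant `u` (meant to be `1/|Γ|`): the `|Γ|` relabelled copies
`C^γ` of `C` on shared input gates, summed by `avg` and rescaled by `u` at the output; `Γ`
permutes the copies, so the circuit is `Γ`-symmetric (Dawar–Wilsenach Def. 3.7) by construction.
[folklore] -/
def orbitAvgCircuit : SymmetricArithmeticCircuit Γ 𝔽 X Unit (C.OAGate Γ u) where
  children := C.oaChildren Γ u
  label := C.oaLabel Γ u
  output _ := .out
  wf := Subrelation.wf (fun {h g} (hh : h ∈ C.oaChildren Γ u g) => C.rank_lt_of_mem_oaChildren u hh)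
    (InvImage.wf OrbitAvgGate.rank Nat.lt_wfRel.wf)
  isInput_iff g := by
    cases g with
    | node γ p =>
      simp only [oaLabel, not_isInput_nodeLabel, oaChildren, false_iff]
      exact (C.nodeChildren_nonempty u γ p _).ne_empty
    | avg =>
      simp only [oaLabel, CircuitLabel.not_isInput_add, oaChildren, Finset.image_eq_empty,
        Finset.univ_eq_empty_iff, false_iff]
      exact fun h => h.elim 1
    | _ => simp [oaLabel, oaChildren]
  eq_of_label_eq g g' hg hl := by
    cases g <;> cases g' <;> simp_all [oaLabel, not_isInput_nodeLabel]
  output_injective := fun _ _ _ => Subsingleton.elim _ _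
  children_smul δ g := by
    cases g with
    | inp x => simp [oaChildren]
    | cst c => simp [oaChildren]
    | node γ p =>
      simp only [OrbitAvgGate.smul_node, oaChildren]
      exact C.nodeChildren_smul u δ γ p _
    | copy γ p => simp [oaChildren]
    | zero' => simp [oaChildren]
    | avg =>
      ext h
      simp only [OrbitAvgGate.smul_avg, oaChildren, Finset.mem_image, Finset.mem_univ, true_and,
        Finset.mem_map, Equiv.toEmbedding_apply, MulAction.toPerm_apply]
      constructor
      · rintro ⟨γ, rfl⟩
        exact ⟨.node (δ⁻¹ * γ) C.lastFin, ⟨δ⁻¹ * γ, rfl⟩, by simp⟩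
      · rintro ⟨_, ⟨γ, rfl⟩, rfl⟩
        exact ⟨δ * γ, rfl⟩
    | out => simp [oaChildren, Finset.map_insert]
  label_smul δ g := by cases g <;> simp [oaLabel]
  output_smul _ _ := rfl

omit [Group Γ] [MulAction Γ X] [DecidableEq X] [DecidableEq Γ] in
/-- The size of the orbit-averaging circuit: `|X| + |constSet| + 2|Γ||C| + 3 ≤
|X| + (2|Γ| + 1)|C| + 5`. [folklore] -/
theorem card_oaGate_le [Fintype X] :
    Fintype.card (C.OAGate Γ u) ≤ Fintype.card X + (2 * Fintype.card Γ + 1) * C.size + 5 := by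
  show Fintype.card (OrbitAvgGate X Γ (C.constSet u) C.size) ≤ _
  rw [OrbitAvgGate.card_eq, Fintype.card_coe]
  have := C.card_constSet_le u
  nlinarith

end Gates

end PICircuit

end Literature.Computability.AlgebraicComplexity
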